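import Summits.ValiantsHypothesis.ValiantsHypothesis.Theorems.DepthWindowFusedPaths
import Summits.ValiantsHypothesis.ValiantsHypothesis.Theorems.DepthWindowProdComponent
import Mathlib.Data.Fintype.BigOperators
import HarnessLib

/-!
# Route `DepthWindow`, g8 — piece (iv′): the FUSED component gadget (one product level saved)

The fused form of piece (iv) of the `(2,3)` SLIVER LEMMA (lens-4 NODE-v8 §12, SPEC (iv′) of
v8/SliverSpec.lean), fully assembled.  Hypotheses: the weight-`0` components of the factors are
scalars `[U_l]_0 = C (u0 l)` and each positive-weight component `[U_l]_ω` (`1 ≤ ω ≤ d`, `l < t`) is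
PRESENTED as `Σ_{s<S} C (coef l ω s) · ∏_{j<m} op l ω s j` over operands of product-depth `≤ D₀` into
a homogeneous gate list `Ψ₀`, rows of weight `ω`.  Conclusion: ONE appended homogeneous `Σ Π Σ Π`
gadget of product-depth `≤ D₀ + 2` computes `[U_0 ⋯ U_{t-1}]_e` — versus `D₀' + 2` with `D₀' = D₀ + 1`
for the unfused `exists_gates_prod_component` fed with component operands.  For the `(2,3)` sliver:
`op` = power-sum data at depth `1`, output depth `3`.

Assembly = `Theorems/DepthWindowProdComponent.lean` with the inner index enlarged to
(fixed-endpoint path, term choices) (`leafTabF`, `coefTabF`, padded into a uniform range), the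
fused path products of `Theorems/DepthWindowFusedPaths.lean`, a scalar outer coefficient
(`finVec_eq_C_finCoef`) and no extra outer factors.  Nothing here bears on `VP ≠ VNP`.

[cite: LimayeSrinivasanTavenas2025, Lemma 11] [cite: Burgisser2000, Def. 2.1]
-/

set_option linter.dupNamespace false

namespace Summit.ValiantsHypothesis.ValiantsHypothesis.Theorems.DepthWindow

open Finset MvPolynomial Literature.Computability.AlgebraicComplexity ArithCircuit

/-- Inner indices of the fused form: (fixed-endpoint inner path, term choices). -/
abbrev InnerF (d t b S : ℕ) (x y : StT d t) : Type :=
  PathsFix (StT d t) b x y × (Fin b → Fin S)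

/-- Counting the fused inner indices. -/
theorem card_innerF_le (d t b S : ℕ) (x y : StT d t) :
    Fintype.card (InnerF d t b S x y) ≤ ((d + 1) * (t + 1)) ^ (b + 1) * S ^ b := by
  rw [Fintype.card_prod, Fintype.card_fun, Fintype.card_fin, Fintype.card_fin]
  exact Nat.mul_le_mul_right _ (card_pathsFix_le d t b x y)

variable {k : Type*} [CommRing k] {τ : Type*}

/-- The scalar terminal coefficient `[y₁ = e] · ∏_{l ≥ y₂} u0 l`. -/
noncomputable def finCoef (d t e : ℕ) (u0 : ℕ → k) (y : StT d t) : k :=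
  if (y.1 : ℕ) = e then ∏ l ∈ Ico (y.2 : ℕ) t, u0 l else 0

/-- With scalar weight-`0` components the terminal vector is scalar. -/
theorem finVec_eq_C_finCoef (w : τ → ℕ) (d t e : ℕ) (U : ℕ → MvPolynomial τ k) (u0 : ℕ → k)
    (h0 : ∀ l, l < t → weightedHomogeneousComponent w 0 (U l) = C (u0 l)) (y : StT d t) :
    finVec w d t e U y = C (finCoef d t e u0 y) := by
  unfold finVec finCoef
  by_cases hy : (y.1 : ℕ) = e
  · rw [if_pos hy, if_pos hy, map_prod]
    refine Finset.prod_congr rfl fun l hl => h0 l ?_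
    rw [Finset.mem_Ico] at hl
    omega
  · rw [if_neg hy, if_neg hy, C_0]

/-- The padded fused leaf table of block `q` of the good outer index `g`. -/
noncomputable def leafTabF (d t S m : ℕ) (op : ℕ → ℕ → Fin S → Fin m → Operand k τ)
    (e a b nB : ℕ) (g : GoodT d t e a) (q : Fin a) (β : Fin nB) (u' : Fin (b * m)) : Operand k τ :=
  if hβ : (β : ℕ) < Fintype.card (InnerF d t b S (g.1.2.2.1 q.castSucc) (g.1.2.2.1 q.succ)) then
    fusedLeaf d t S m op (g.1.1 : ℕ) a b q
      ((Fintype.equivFin (InnerF d t b S (g.1.2.2.1 q.castSucc) (g.1.2.2.1 q.succ))).symm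
        ⟨β, hβ⟩).1.1
      ((Fintype.equivFin (InnerF d t b S (g.1.2.2.1 q.castSucc) (g.1.2.2.1 q.succ))).symm
        ⟨β, hβ⟩).2 u'
  else Operand.const 0

/-- The padded fused coefficient table. -/
noncomputable def coefTabF (d t S : ℕ) (u0 : ℕ → k) (coef : ℕ → ℕ → Fin S → k)
    (e a b nB : ℕ) (g : GoodT d t e a) (q : Fin a) (β : Fin nB) : k :=
  if hβ : (β : ℕ) < Fintype.card (InnerF d t b S (g.1.2.2.1 q.castSucc) (g.1.2.2.1 q.succ)) then
    fusedCoef d t S u0 coef (g.1.1 : ℕ) a b q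
      ((Fintype.equivFin (InnerF d t b S (g.1.2.2.1 q.castSucc) (g.1.2.2.1 q.succ))).symm
        ⟨β, hβ⟩).1.1
      ((Fintype.equivFin (InnerF d t b S (g.1.2.2.1 q.castSucc) (g.1.2.2.1 q.succ))).symm
        ⟨β, hβ⟩).2
  else 0

section Tables

variable (w : τ → ℕ) (d t S m : ℕ) (U : ℕ → MvPolynomial τ k) (u0 : ℕ → k)
  (coef : ℕ → ℕ → Fin S → k) (op : ℕ → ℕ → Fin S → Fin m → Operand k τ)
  (V : List (MvPolynomial τ k)) (D : List ℕ) (n D₀ : ℕ) (e a b nB : ℕ)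

/-- References of the padded fused leaf table. -/
theorem leafTabF_refsBelow
    (hrefs : ∀ l ω s j, l < t → 1 ≤ ω → ω ≤ d → (op l ω s j).RefsBelow n)
    (g : GoodT d t e a) (q : Fin a) (β : Fin nB) (u' : Fin (b * m)) :
    (leafTabF d t S m op e a b nB g q β u').RefsBelow n := by
  unfold leafTabF
  by_cases hβ : (β : ℕ) < Fintype.card (InnerF d t b S (g.1.2.2.1 q.castSucc) (g.1.2.2.1 q.succ))
  · rw [dif_pos hβ]; exact fusedLeaf_refsBelow d t S m op n hrefs _ a b q _ _ u'
  · rw [dif_neg hβ]; trivial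

/-- Depth of the padded fused leaf table. -/
theorem leafTabF_depthIn
    (hdp : ∀ l ω s j, l < t → 1 ≤ ω → ω ≤ d → (op l ω s j).depthIn D ≤ D₀)
    (g : GoodT d t e a) (q : Fin a) (β : Fin nB) (u' : Fin (b * m)) :
    (leafTabF d t S m op e a b nB g q β u').depthIn D ≤ D₀ := by
  unfold leafTabF
  by_cases hβ : (β : ℕ) < Fintype.card (InnerF d t b S (g.1.2.2.1 q.castSucc) (g.1.2.2.1 q.succ))
  · rw [dif_pos hβ]; exact fusedLeaf_depthIn d t S m op D D₀ hdp _ a b q _ _ u'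
  · rw [dif_neg hβ]; exact Nat.zero_le _

/-- Weights of the padded fused leaf rows: the degree increment of block `q`. -/
theorem prod_leafTabF_isWeightedHomogeneous (hm : 1 ≤ m) (hpos : 0 < b * m)
    (hw : ∀ l ω s, l < t → 1 ≤ ω → ω ≤ d →
      IsWeightedHomogeneous w (∏ j : Fin m, (op l ω s j).eval V) ω)
    (g : GoodT d t e a) (q : Fin a) (β : Fin nB) :
    IsWeightedHomogeneous w (∏ u' : Fin (b * m), (leafTabF d t S m op e a b nB g q β u').eval V)
      (((g.1.2.2.1 q.succ).1 : ℕ) - (g.1.2.2.1 q.castSucc).1) := by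
  unfold leafTabF
  by_cases hβ : (β : ℕ) < Fintype.card (InnerF d t b S (g.1.2.2.1 q.castSucc) (g.1.2.2.1 q.succ))
  · simp only [dif_pos hβ]
    set p := (Fintype.equivFin
      (InnerF d t b S (g.1.2.2.1 q.castSucc) (g.1.2.2.1 q.succ))).symm ⟨β, hβ⟩ with hp
    have h := prod_fusedLeaf_isWeightedHomogeneous w d t S m op V hm hw (g.1.1 : ℕ) a b q p.1.1 p.2
    have h0 : p.1.1 0 = g.1.2.2.1 q.castSucc := p.1.2.1
    have h1 : p.1.1 (Fin.last b) = g.1.2.2.1 q.succ := p.1.2.2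
    rw [h0, h1] at h
    exact h
  · simp only [dif_neg hβ]
    rw [Finset.prod_eq_zero (Finset.mem_univ (⟨0, hpos⟩ : Fin (b * m)))
      (by simp only [Operand.eval, C_0])]
    exact isWeightedHomogeneous_zero k w _

/-- Value of the padded fused inner sums: the fixed-endpoint inner path sum of block `q`. -/
theorem sum_coefTabF_prod_leafTabF_eval (hS : 1 ≤ S)
    (h0 : ∀ l, l < t → weightedHomogeneousComponent w 0 (U l) = C (u0 l))
    (hpres : ∀ l ω, l < t → 1 ≤ ω → ω ≤ d →
      ∑ s : Fin S, C (coef l ω s) * ∏ j : Fin m, (op l ω s j).eval V =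
        weightedHomogeneousComponent w ω (U l))
    (g : GoodT d t e a) (q : Fin a) :
    ∑ β : Fin (((d + 1) * (t + 1)) ^ (b + 1) * S ^ b),
        C (coefTabF d t S u0 coef e a b (((d + 1) * (t + 1)) ^ (b + 1) * S ^ b) g q β) *
          ∏ u' : Fin (b * m),
            (leafTabF d t S m op e a b (((d + 1) * (t + 1)) ^ (b + 1) * S ^ b) g q β u').eval V =
      ∑ s : PathsFix (StT d t) b (g.1.2.2.1 q.castSucc) (g.1.2.2.1 q.succ),
        pathWeight (fun u : Fin b =>
          padLayers (jumpMat w d t U) (g.1.1 : ℕ) (a * b) ⟨(q : ℕ) * b + u, blockIndex_lt q u⟩) s.1 := by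
  have hrhs : ∑ s : PathsFix (StT d t) b (g.1.2.2.1 q.castSucc) (g.1.2.2.1 q.succ),
        pathWeight (fun u : Fin b =>
          padLayers (jumpMat w d t U) (g.1.1 : ℕ) (a * b) ⟨(q : ℕ) * b + u, blockIndex_lt q u⟩) s.1 =
      ∑ p : InnerF d t b S (g.1.2.2.1 q.castSucc) (g.1.2.2.1 q.succ),
        C (fusedCoef d t S u0 coef (g.1.1 : ℕ) a b q p.1.1 p.2) *
          ∏ u' : Fin (b * m), (fusedLeaf d t S m op (g.1.1 : ℕ) a b q p.1.1 p.2 u').eval V := by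
    rw [Fintype.sum_prod_type]
    exact Finset.sum_congr rfl fun s _ =>
      pathWeight_eq_sum_fused w d t S m U u0 coef op V hS h0 hpres _ a b q s.1
  rw [hrhs, ← sum_fin_pad (((d + 1) * (t + 1)) ^ (b + 1) * S ^ b) (card_innerF_le d t b S _ _)]
  refine Finset.sum_congr rfl fun β _ => ?_
  unfold coefTabF leafTabF
  by_cases hβ : (β : ℕ) < Fintype.card (InnerF d t b S (g.1.2.2.1 q.castSucc) (g.1.2.2.1 q.succ))
  · simp only [dif_pos hβ]
  · simp only [dif_neg hβ, C_0, zero_mul]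

end Tables

/-- **Piece (iv′), fused: the weight-`e` component of a product of `t` factors with PRESENTED
components over operands of product-depth `≤ D₀` is computed by an appended homogeneous `Σ Π Σ Π`
gadget of product-depth `≤ D₀ + 2`.** [cite: LimayeSrinivasanTavenas2025, Lemma 11] -/
theorem exists_gates_prod_component_fused (w : τ → ℕ) (Ψ₀ : List (Gate k τ))
    (d t e a b D₀ S m : ℕ) (he : e ≤ d) (hab : e ≤ a * b) (hb : 1 ≤ b) (hS : 1 ≤ S) (hm : 1 ≤ m)
    (U : ℕ → MvPolynomial τ k) (u0 : ℕ → k)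
    (coef : ℕ → ℕ → Fin S → k) (op : ℕ → ℕ → Fin S → Fin m → Operand k τ)
    (h0 : ∀ l, l < t → weightedHomogeneousComponent w 0 (U l) = C (u0 l))
    (hpres : ∀ l ω, l < t → 1 ≤ ω → ω ≤ d →
      ∑ s : Fin S, C (coef l ω s) * ∏ j : Fin m, (op l ω s j).eval (gateValues Ψ₀) =
        weightedHomogeneousComponent w ω (U l))
    (hw : ∀ l ω s, l < t → 1 ≤ ω → ω ≤ d →
      IsWeightedHomogeneous w (∏ j : Fin m, (op l ω s j).eval (gateValues Ψ₀)) ω)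
    (hrefs : ∀ l ω s j, l < t → 1 ≤ ω → ω ≤ d → (op l ω s j).RefsBelow Ψ₀.length)
    (hdp : ∀ l ω s j, l < t → 1 ≤ ω → ω ≤ d →
      (op l ω s j).depthIn (gateWDepths prodWeight Ψ₀) ≤ D₀)
    (hhom₀ : ∀ g ∈ gateValues Ψ₀, ∃ e' : ℕ, IsWeightedHomogeneous w g e') :
    ∃ (Δ : List (Gate k τ)) (o : Operand k τ),
      Δ.length ≤ ((e + 1) * ((d + 1) * (t + 1)) ^ (a + 2) + 1) *
          (a * (((d + 1) * (t + 1)) ^ (b + 1) * S ^ b + 1) + 1) ∧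
      (∀ vs : List (Operand k τ), Gate.prod vs ∈ Δ → vs.length = b * m ∨ vs.length = a) ∧
      (∀ g ∈ gateValues (Ψ₀ ++ Δ), ∃ e' : ℕ, IsWeightedHomogeneous w g e') ∧
      (∀ y ∈ gateWDepths prodWeight (Ψ₀ ++ Δ), y ∈ gateWDepths prodWeight Ψ₀ ∨ y ≤ D₀ + 2) ∧
      o.RefsBelow (Ψ₀ ++ Δ).length ∧
      o.depthIn (gateWDepths prodWeight (Ψ₀ ++ Δ)) ≤ D₀ + 2 ∧
      IsWeightedHomogeneous w (o.eval (gateValues (Ψ₀ ++ Δ))) e ∧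
      o.eval (gateValues (Ψ₀ ++ Δ)) = weightedHomogeneousComponent w e (∏ l ∈ range t, U l) := by
  have hpos : 0 < b * m := Nat.mul_pos (by omega) (by omega)
  obtain ⟨Δ, o, hlen, hfan, hhom, hdepths, horefs, hodp, hoW, hoval⟩ :=
    exists_append_sumProdSumProdMul w (nA := Fintype.card (GoodT d t e a))
      (nB := ((d + 1) * (t + 1)) ^ (b + 1) * S ^ b) (a := a) (b := b * m) (x := 0) Ψ₀
      (fun i => finCoef d t e u0 ((Fintype.equivFin (GoodT d t e a)).symm i).1.2.1)
      (fun i q β => coefTabF d t S u0 coef e a b (((d + 1) * (t + 1)) ^ (b + 1) * S ^ b)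
        ((Fintype.equivFin (GoodT d t e a)).symm i) q β)
      (fun i q β u' => leafTabF d t S m op e a b (((d + 1) * (t + 1)) ^ (b + 1) * S ^ b)
        ((Fintype.equivFin (GoodT d t e a)).symm i) q β u')
      (fun _ v => Fin.elim0 v)
      D₀ e
      (fun i q => ((((Fintype.equivFin (GoodT d t e a)).symm i).1.2.2.1 q.succ).1 : ℕ) -
        (((Fintype.equivFin (GoodT d t e a)).symm i).1.2.2.1 q.castSucc).1)
      (fun _ => 0)
      (fun i q β u' => leafTabF_refsBelow d t S m op _ e a b _ hrefs _ q β u')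
      (fun i q β u' => leafTabF_depthIn d t S m op _ D₀ e a b _ hdp _ q β u')
      (fun _ v => Fin.elim0 v)
      (fun _ v => Fin.elim0 v)
      hhom₀
      (fun i q β => prod_leafTabF_isWeightedHomogeneous w d t S m op (gateValues Ψ₀) e a b _
        hm hpos hw _ q β)
      (fun i => by
        rw [Fin.prod_univ_zero]
        exact isWeightedHomogeneous_one k w)
      (fun i => by
        rw [add_zero]
        exact sum_blockWt_eq_of_good e ((Fintype.equivFin (GoodT d t e a)).symm i).1
          ((Fintype.equivFin (GoodT d t e a)).symm i).2.1 ((Fintype.equivFin (GoodT d t e a)).symm i).2.2)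
  refine ⟨Δ, o, ?_, fun vs h => (hfan vs h).imp id (fun h' => h'), hhom, hdepths, horefs, hodp, hoW, ?_⟩
  · -- the count
    rw [hlen]
    have hA := card_goodT_le d t e a
    have h1 : (Fintype.card (GoodT d t e a) + 1) *
          (a * (((d + 1) * (t + 1)) ^ (b + 1) * S ^ b + 1) + 1) =
        Fintype.card (GoodT d t e a) * a * (((d + 1) * (t + 1)) ^ (b + 1) * S ^ b + 1) +
          (Fintype.card (GoodT d t e a) + 1) + a * (((d + 1) * (t + 1)) ^ (b + 1) * S ^ b + 1) := by
      ring
    calc Fintype.card (GoodT d t e a) * a * (((d + 1) * (t + 1)) ^ (b + 1) * S ^ b + 1) +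
          (Fintype.card (GoodT d t e a) + 1)
        ≤ (Fintype.card (GoodT d t e a) + 1) *
            (a * (((d + 1) * (t + 1)) ^ (b + 1) * S ^ b + 1) + 1) := by rw [h1]; omega
      _ ≤ ((e + 1) * ((d + 1) * (t + 1)) ^ (a + 2) + 1) *
            (a * (((d + 1) * (t + 1)) ^ (b + 1) * S ^ b + 1) + 1) :=
          Nat.mul_le_mul_right _ (by omega)
  · -- the value
    rw [hoval]
    simp only [Fin.prod_univ_zero, mul_one,
      sum_coefTabF_prod_leafTabF_eval w d t S m U u0 coef op (gateValues Ψ₀) e a b hS h0 hpres,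
      ← finVec_eq_C_finCoef w d t e U u0 h0]
    rw [weightedHomogeneousComponent_prod_eq_twoLevel_good w d t e a b he hab U,
      ← sum_goodT_eq_sum_filter]
    exact Fintype.sum_equiv (Fintype.equivFin (GoodT d t e a)).symm _ _ fun _ => rfl

end Summit.ValiantsHypothesis.ValiantsHypothesis.Theorems.DepthWindow
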